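import Summits.Ventures.Crystal3D.Kissing125.GSearchNode1
import HarnessLib

/-!
# Soundness of the node rule and of propagation, κ-generic — part 2/3

HONEST FRAMING (cell pub-crystal3d, K-path at `h = 5/4`, V4 = κ as an explicit parameter): this is NOT a result printed
by Hales; it is his METHOD (arXiv:1209.6043, Theorem 3 + Lemmas 7–10, in the tree's form of a verified interval-arithmetic
growth search, `Literature/…/KissingSearch*.lean`) with the largest long-side cosine `κ` made an EXPLICIT PARAMETER
(`κ : Kappa`, carrying the two numeric facts the soundness proof uses: `-1/2 ≤ κ`, `κ < 1/4`).  Only the declarations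
whose statement depends on `κ` are declared here (namespace `…Kissing125.GSearch`, the tree's short names, no renames);
every κ-free helper is the landed K25 copy (`…Kissing125.KissingSearch.*`) and every κ-free lemma is cited from the tree
(PRIVATE per-file citation aliases; `GSearchTransport.lean` holds `toT : St → tree St` and the transport equalities).  The K25
instance is `κ25 = ⟨7/32, …⟩`; `GSearchBridge.lean` identifies the generic checker at
`κ25` with the landed `Kissing125.KissingSearch.checkPart`, so the landed run files are consumed unchanged.  Generated by
`HOME/lean/kissing125/v4-prep/gen/mkgen.py`; nothing here is asserted about GAP(1.26) or any census.

THIS FILE: the κ-tainted declarations of `Literature/Geometry/DiscreteGeometry/KissingSearchNode.lean` (part 2 of 3), with `κ : Kappa` threaded; κ-free declarations of that file are NOT re-declared publicly (the κ-free helpers are the landed K25 copies; the κ-free tree lemmas used by the proofs are cited through PRIVATE aliases at the top of the file).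

## References
* T. C. Hales, *A proof of Fejes Tóth's conjecture on sphere packings with kissing number twelve*,
  arXiv:1209.6043 (2012): Definition 1, Theorem 2, Theorem 3, Lemmas 7–10. [`Hales2012`]
* R. E. Moore, *Interval Analysis* (1966), Theorem 3.1, §4.4. [`Moore1966`]
-/

namespace Summit.Ventures.Crystal3D.Kissing125

open Literature.Geometry.DiscreteGeometry
open Summit.Ventures.Crystal3D.Kissing125.KissingSearch

namespace GSearch

open Real Literature.Analysis.ValidatedNumerics KissingLP NonemptyInterval Finset

variable {κ : Kappa}

/-! ### κ-free tree lemmas used below, read over the K25 copies (PRIVATE citation aliases; the public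
surface of this file is κ-generic only) -/

/-- K25 reading of the tree lemma `NS_eq` (κ-free; proof = citation of the tree lemma). [folklore] -/
private theorem NS_eq : NS = 16 :=
  Literature.Geometry.DiscreteGeometry.KissingSearch.NS_eq

/-- K25 reading of the tree lemma `delta_pos` (κ-free; proof = citation of the tree lemma). [folklore] -/
private theorem delta_pos : 0 < (↑δ : ℝ) :=
  Literature.Geometry.DiscreteGeometry.KissingSearch.delta_pos

/-- K25 reading of the tree lemma `eq_of_tset_eq` (κ-free; proof = citation of the tree lemma). [folklore] -/
private theorem eq_of_tset_eq {s t : ℕ} (hs : TriValid s) (ht : TriValid t)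
  (hst : tset s = tset t) : s = t :=
  Literature.Geometry.DiscreteGeometry.KissingSearch.eq_of_tset_eq hs ht hst

/-- K25 reading of the tree lemma `exists_common_of_inter_two` (κ-free; proof = citation of the tree lemma). [folklore] -/
private theorem exists_common_of_inter_two {t t' : Finset ℕ} (v : ℕ)
  (h2 : #(t ∩ t') = 2) : ∃ x, x ≠ v ∧ x ∈ t ∧ x ∈ t' :=
  Literature.Geometry.DiscreteGeometry.KissingSearch.exists_common_of_inter_two v h2

/-- K25 reading of the tree lemma `linkClosed_iff` (κ-free; proof = citation of the tree lemma). [folklore] -/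
private theorem linkClosed_iff (s : St) (v : ℕ) (C : List ℕ) :
  s.linkClosed v C = true ↔ ∀ x ∈ C, ∀ y ∈ s.linkNbrs v x, y ∈ C :=
  Literature.Geometry.DiscreteGeometry.KissingSearch.linkClosed_iff (toT s) v C

/-- K25 reading of the tree lemma `linkSummary_eq` (κ-free; proof = citation of the tree lemma). [folklore] -/
private theorem linkSummary_eq (s : St) (v : ℕ) :
  s.linkSummary v =
    ((List.filter (fun u ↦ decide (u ≠ v ∧ s.gsc v u ≠ 0)) (List.range' 0 12)).length,
      (List.filter (fun u ↦ decide (u ≠ v ∧ s.gsc v u = 1)) (List.range' 0 12)).length,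
      (List.range' 0 12).any fun u ↦ decide (u ≠ v ∧ 3 ≤ s.gsc v u),
      (List.filter (fun u ↦ decide (u ≠ v ∧ s.gsc v u ≠ 0)) (List.range' 0 12)).reverse) :=
  by rw [linkSummary_tr]; exact Literature.Geometry.DiscreteGeometry.KissingSearch.linkSummary_eq (toT s) v

/-- K25 reading of the tree lemma `lt_of_mem_tset` (κ-free; proof = citation of the tree lemma). [folklore] -/
private theorem lt_of_mem_tset {t v : ℕ} (ht : TriValid t) (hv : v ∈ tset t) : v < 12 :=
  Literature.Geometry.DiscreteGeometry.KissingSearch.lt_of_mem_tset ht hv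

/-- K25 reading of the tree lemma `mem_trisAt` (κ-free; proof = citation of the tree lemma). [folklore] -/
private theorem mem_trisAt {s : St} {v t : ℕ} :
  t ∈ s.trisAt v ↔ t ∈ s.tris.toList ∧ tmem t v = true :=
  Literature.Geometry.DiscreteGeometry.KissingSearch.mem_trisAt (s := toT s)

/-- K25 reading of the tree lemma `others_spec` (κ-free; proof = citation of the tree lemma). [folklore] -/
private theorem others_spec {t v : ℕ} (ht : TriValid t) (hv : v ∈ tset t) :
  v ≠ (others t v).1 ∧
    v ≠ (others t v).2 ∧ (others t v).1 ≠ (others t v).2 ∧ tset t = {v, (others t v).1, (others t v).2} :=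
  Literature.Geometry.DiscreteGeometry.KissingSearch.others_spec ht hv

/-- K25 reading of the tree lemma `subset_linkReach` (κ-free; proof = citation of the tree lemma). [folklore] -/
private theorem subset_linkReach (s : St) (v fuel : ℕ) (seen front : List ℕ)
  {a : ℕ} : a ∈ seen → a ∈ s.linkReach v fuel seen front :=
  by rw [linkReach_tr]; exact Literature.Geometry.DiscreteGeometry.KissingSearch.subset_linkReach (toT s) v fuel seen front

/-- K25 reading of the tree lemma `tmem_iff` (κ-free; proof = citation of the tree lemma). [folklore] -/
private theorem tmem_iff {t v : ℕ} : tmem t v = true ↔ v ∈ tset t :=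
  Literature.Geometry.DiscreteGeometry.KissingSearch.tmem_iff

/-- K25 reading of the tree lemma `trisAt_eq_filter` (κ-free; proof = citation of the tree lemma). [folklore] -/
private theorem trisAt_eq_filter (s : St) (v : ℕ) :
  s.trisAt v = List.filter (fun t ↦ tmem t v) s.tris.toList :=
  Literature.Geometry.DiscreteGeometry.KissingSearch.trisAt_eq_filter (toT s) v


section Link
variable {M : KConf κ} {s : St}
/-- **A verified closed proper component of the placed link contradicts the link axiom.**
[cite: Hales2012, proof of Lemma 9] -/
theorem false_of_closed_component {M : KConf κ} {s : St} (hR : Realizes M s) {v : ℕ} (hv : v < 12) {C : List ℕ} {a z : ℕ}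
    (haC : a ∈ C) (ha : a < 12) (hav : a ≠ v) (hga : s.gsc v a ≠ 0)
    (hcl : ∀ x ∈ C, ∀ y ∈ s.linkNbrs v x, y ∈ C) (h2 : ∀ x ∈ C, s.gsc v x = 2)
    (hz : z < 12) (hzv : z ≠ v) (hgz : s.gsc v z ≠ 0) (hzC : z ∉ C) : False := by
  classical
  -- the placed triangles at `v` whose other vertices are in `C`
  set A : Finset (Finset ℕ) := (M.T.filter fun t' => v ∈ t').filter
    fun t' => ∃ t ∈ s.tris.toList, tset t = t' ∧ ∀ x ∈ t', x ≠ v → x ∈ C with hA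
  have hAsub : A ⊆ M.T.filter fun t' => v ∈ t' := Finset.filter_subset _ _
  -- a placed triangle through `{v, a}`
  have exa : ∃ t ∈ s.tris.toList, v ∈ tset t ∧ a ∈ tset t := by
    rw [gsc_eq_length hR hv ha hav.symm] at hga
    obtain ⟨t, ht⟩ := List.exists_mem_of_ne_nil (s.onSideL v a) (fun h => hga (by rw [h]; rfl))
    unfold St.onSideL at ht
    rw [List.mem_filter] at ht
    simp only [Bool.and_eq_true] at ht
    exact ⟨t, ht.1, tmem_iff.1 ht.2.1, tmem_iff.1 ht.2.2⟩
  -- membership criterion for `A`: a placed triangle `{v, x, y}` with `x ∈ C` (then `y ∈ C`)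
  have crit : ∀ t ∈ s.tris.toList, ∀ x, v ∈ tset t → x ∈ tset t → x ≠ v → x ∈ C → tset t ∈ A := by
    intro t ht x hvt hxt hxv hxC
    obtain ⟨n1, n2, n12, hset⟩ := others_spec (hR.valid t ht) hvt
    -- the third vertex `y`
    have hx3 : x = (others t v).1 ∨ x = (others t v).2 := by
      rw [hset] at hxt; simp only [Finset.mem_insert, Finset.mem_singleton] at hxt
      rcases hxt with h | h | h
      · exact absurd h hxv
      · exact Or.inl h
      · exact Or.inr h
    obtain ⟨y, hy⟩ : ∃ y, tset t = {v, x, y} := by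
      rcases hx3 with h | h
      · exact ⟨(others t v).2, by rw [hset, h]⟩
      · exact ⟨(others t v).1, by rw [hset, h]; ext z; simp only [Finset.mem_insert, Finset.mem_singleton]; tauto⟩
    have hyN : y ∈ s.linkNbrs v x := (mem_linkNbrs hR hxv).2 ⟨t, ht, hvt, hxt, hy⟩
    have hyC : y ∈ C := hcl x hxC y hyN
    rw [hA, Finset.mem_filter, Finset.mem_filter]
    refine ⟨⟨hR.mem t ht, hvt⟩, t, ht, rfl, fun w hw hwv => ?_⟩
    rw [hy] at hw
    simp only [Finset.mem_insert, Finset.mem_singleton] at hw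
    rcases hw with rfl | rfl | rfl
    · exact absurd rfl hwv
    · exact hxC
    · exact hyC
  obtain ⟨t₀, ht₀, hv₀, ha₀⟩ := exa
  have hAne : A.Nonempty := ⟨tset t₀, crit t₀ ht₀ a hv₀ ha₀ hav haC⟩
  have hclA : ∀ t ∈ A, ∀ t' ∈ M.T, v ∈ t' → (t ∩ t').card = 2 → t' ∈ A := by
    intro t ht t' ht' hvt' hint
    rw [hA, Finset.mem_filter, Finset.mem_filter] at ht
    obtain ⟨⟨-, hvt⟩, tp, htp, rfl, hall⟩ := ht
    obtain ⟨x, hxv, hx, hx'⟩ := exists_common_of_inter_two v hint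
    have hxC : x ∈ C := hall x hx hxv
    have hx12 : x < 12 := lt_of_mem_tset (hR.valid tp htp) hx
    obtain ⟨t₁, ht₁, e⟩ := placed_of_gsc_two hR hv hx12 hxv.symm (h2 x hxC) ht' hvt' hx'
    rw [← e]
    exact crit t₁ ht₁ x (by rw [e]; exact hvt') (by rw [e]; exact hx') hxv hxC
  have hAeq := M.link v hv A hAsub hAne hclA
  -- the placed triangle through `{v, z}` is in `A`, so `z ∈ C`
  rw [gsc_eq_length hR hv hz hzv.symm] at hgz
  obtain ⟨tz, htz⟩ := List.exists_mem_of_ne_nil (s.onSideL v z) (fun h => hgz (by rw [h]; rfl))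
  unfold St.onSideL at htz
  rw [List.mem_filter] at htz
  simp only [Bool.and_eq_true] at htz
  have hzT : tset tz ∈ A := by
    rw [hAeq, Finset.mem_filter]; exact ⟨hR.mem tz htz.1, tmem_iff.1 htz.2.1⟩
  rw [hA, Finset.mem_filter, Finset.mem_filter] at hzT
  obtain ⟨-, tp, htp, e, hall⟩ := hzT
  exact hzC (hall z (tmem_iff.1 htz.2.2) hzv)

/-- **The link kill is sound**: in a realized state `badLink` is `false`. [folklore] -/
theorem not_badLink {M : KConf κ} {s : St} (hR : Realizes M s) {v : ℕ} (hv : v < 12) :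
    s.badLink v (s.linkSummary v).2.2.2 (s.linkSummary v).2.2.1 = false := by
  rw [linkSummary_eq]
  simp only
  unfold St.badLink
  rw [Bool.or_eq_false_iff]
  constructor
  · -- no side in `≥ 3` placed triangles
    rw [List.any_eq_false]
    intro u hu h
    simp only [decide_eq_true_eq] at h
    rw [List.mem_range'_1] at hu
    have := gsc_le_two hR hv (by omega) h.1.symm
    omega
  · -- no verified closed proper component
    set verts := ((List.range' 0 12).filter fun u => u ≠ v ∧ s.gsc v u ≠ 0).reverse with hverts
    have hmem : ∀ u, u ∈ verts ↔ u < 12 ∧ u ≠ v ∧ s.gsc v u ≠ 0 := by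
      intro u; rw [hverts, List.mem_reverse, List.mem_filter, List.mem_range'_1]
      simp only [decide_eq_true_eq]; omega
    -- the fold: its flag becomes `true` only through a witness
    suffices h : ∀ (L : List ℕ) (acc : List ℕ × Bool), (∀ a ∈ L, a ∈ verts) → acc.2 = false →
        (L.foldl (fun (acc : List ℕ × Bool) a =>
          if (acc.2 || acc.1.contains a) = true then acc
          else (s.linkReach v 24 [a] [a] ++ acc.1,
            s.linkClosed v (s.linkReach v 24 [a] [a]) &&
              (s.linkReach v 24 [a] [a]).all (fun x => s.gsc v x == 2) &&
              verts.any fun z => !(s.linkReach v 24 [a] [a]).contains z)) acc).2 = false by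
      exact h verts ([], false) (fun a ha => ha) rfl
    intro L
    induction L with
    | nil => intro acc _ h; simpa using h
    | cons a L ih =>
      intro acc hL hacc
      rw [List.foldl_cons]
      apply ih _ (fun a' ha' => hL a' (by simp [ha']))
      by_cases hskip : (acc.2 || acc.1.contains a) = true
      · rw [if_pos hskip]; exact hacc
      · rw [if_neg hskip]
        simp only
        -- the new flag is false: otherwise a closed proper component
        by_contra hflag
        rw [Bool.not_eq_false, Bool.and_eq_true, Bool.and_eq_true] at hflag
        obtain ⟨⟨hcl, hall⟩, hany⟩ := hflag
        rw [linkClosed_iff] at hcl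
        rw [List.all_eq_true] at hall
        rw [List.any_eq_true] at hany
        obtain ⟨z, hz, hzC⟩ := hany
        have hzC' : z ∉ s.linkReach v 24 [a] [a] := by
          intro hm; simp [hm] at hzC
        have ha := (hmem a).1 (hL a (by simp))
        have hz' := (hmem z).1 hz
        refine false_of_closed_component hR hv (C := s.linkReach v 24 [a] [a])
          (subset_linkReach s v 24 [a] [a] (by simp)) ha.1 ha.2.1 ha.2.2 hcl ?_ hz'.1 hz'.2.1 hz'.2.2 hzC'
        intro x hx
        have := hall x hx
        simpa using this

end Link

/-! ### Part C. Angle sums and the node rule -/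

section Node

variable {M : KConf κ} {s : St}

/-- **Meaning of `slotSums`** when every slot is feasible. [folklore] -/
theorem slotSums_eq_some (s : St) (v : ℕ) : ∀ (tv : List ℕ), (∀ t ∈ tv, St.slotBr κ s t v ≠ NOBR) →
    St.slotSums κ s v tv = some ((tv.map fun t => brLo (St.slotBr κ s t v)).sum, (tv.map fun t => brHi (St.slotBr κ s t v)).sum) := by
  intro tv
  induction tv using List.reverseRecOn with
  | nil => intro _; rfl
  | append_singleton L t ih =>
    intro hL
    have ht := hL t (by simp)
    have ih' := ih (fun t' ht' => hL t' (by simp [ht']))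
    unfold St.slotSums at ih' ⊢
    rw [List.foldl_append, ih', List.foldl_cons, List.foldl_nil]
    simp only [ht, ↓reduceIte, List.map_append, List.map_cons, List.map_nil, List.sum_append, List.sum_cons,
      List.sum_nil, add_zero]

/-- **Every angle of `M` at a vertex is at least `THMIN δ`.** [folklore] -/
theorem THMIN_mul_le_ang (M : KConf κ) {t : Finset ℕ} (hT : t ∈ M.T) {v : ℕ} (hv : v ∈ t) :
    ((THMIN κ : ℕ) : ℝ) * (δ : ℝ) ≤ M.ang t v := by
  obtain ⟨hcard, hlt⟩ := M.mem_T t hT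
  obtain ⟨x, y, z, hxy, hxz, hyz, rfl⟩ := Finset.card_eq_three.1 hcard
  -- name the two other vertices `a, b`
  obtain ⟨a, b, hva, hvb, hab, ha, hb⟩ : ∃ a b, v ≠ a ∧ v ≠ b ∧ a ≠ b ∧ a ∈ ({x, y, z} : Finset ℕ) ∧
      b ∈ ({x, y, z} : Finset ℕ) := by
    simp only [Finset.mem_insert, Finset.mem_singleton] at hv
    rcases hv with rfl | rfl | rfl
    · exact ⟨y, z, hxy, hxz, hyz, by simp, by simp⟩
    · exact ⟨x, z, fun h => hxy h.symm, hyz, hxz, by simp, by simp⟩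
    · exact ⟨x, y, fun h => hxz h.symm, fun h => hyz h.symm, hxy, by simp, by simp⟩
  -- symbols for the three sides
  have sym : ∀ {p q : ℕ}, p ∈ ({x, y, z} : Finset ℕ) → q ∈ ({x, y, z} : Finset ℕ) → p ≠ q →
      ∃ σ, σ ≤ K ∧ SymMem κ σ (M.g p q) := by
    intro p q hp hq hpq
    rcases M.dichot p q (hlt p hp) (hlt q hq) hpq with h | ⟨-, h⟩
    · exact ⟨0, Nat.zero_le _, symMem_zero_iff.2 h⟩
    · have hlo := M.side_bound _ hT p hp q hq hpq
      have h0 : ((gridPt κ (1 - 1) : ℚ) : ℝ) ≤ M.g p q := by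
        have : gridPt κ 0 = -1 / 2 := by unfold gridPt; simp
        rw [show (1 - 1 : ℕ) = 0 from rfl, this]; push_cast; linarith
      have hK : M.g p q ≤ ((gridPt κ K : ℚ) : ℝ) := by
        have : gridPt κ K = κ.val := by unfold gridPt K; ring
        rw [this]; exact h
      obtain ⟨σ, h1, h2, h3⟩ := exists_cell (K - 1) 1 K (by unfold K; norm_num) le_rfl h0 hK
      exact ⟨σ, h2, h3⟩
  obtain ⟨σa, hσa, hxa⟩ := sym hv ha hva
  obtain ⟨σb, hσb, hxb⟩ := sym hv hb hvb
  obtain ⟨σc, hσc, hxc⟩ := sym ha hb hab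
  have hbasic := basic_sound hxa hxb hxc (sq_lt_one_of_symMem hσa hxa) (sq_lt_one_of_symMem hσb hxb)
    (M.circum _ hT v hv a ha b hb hva hvb hab) (M.ang_nonneg _ _) (M.ang_le_pi _ _)
    (M.cos_law _ hT v hv a ha b hb hva hvb hab)
  obtain ⟨hne, hlo, -⟩ := hbasic
  have hK' : K = 15 := rfl
  have hNS : NS = 16 := NS_eq
  have hTH := THMIN_le (by omega) (by omega) (by omega) hne
  exact le_trans (mul_le_mul_of_nonneg_right (by exact_mod_cast hTH) delta_pos.le) hlo

/-- The image of the placed triangles at a closed `v` is the set of all triangles of `M` at `v`,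
and the list angle sum is `2π`. [cite: Hales2012, proof of Lemma 9] -/
theorem sum_ang_trisAt_of_closed {M : KConf κ} {s : St} (hR : Realizes M s) {v : ℕ} (hv : v < 12)
    (hne : ∀ u, u < 12 → u ≠ v → s.gsc v u ≠ 1) (hex : ∃ t ∈ s.tris.toList, v ∈ tset t) :
    ((s.trisAt v).map fun t => M.ang (tset t) v).sum = 2 * π := by
  classical
  have hnd : (s.trisAt v).Nodup := by rw [trisAt_eq_filter]; exact hR.nodup.filter _
  -- list sum = finset sum over the image
  have hinj : ∀ t ∈ s.trisAt v, ∀ t' ∈ s.trisAt v, tset t = tset t' → t = t' := fun t ht t' ht' e =>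
    eq_of_tset_eq (hR.valid t (mem_trisAt.1 ht).1) (hR.valid t' (mem_trisAt.1 ht').1) e
  have himg : ((s.trisAt v).toFinset).image tset = M.T.filter fun t' => v ∈ t' := by
    ext t''
    rw [Finset.mem_image, Finset.mem_filter]
    constructor
    · rintro ⟨t, ht, rfl⟩
      rw [List.mem_toFinset] at ht
      exact ⟨hR.mem t (mem_trisAt.1 ht).1, tmem_iff.1 (mem_trisAt.1 ht).2⟩
    · rintro ⟨hT, hv''⟩
      obtain ⟨t₀, ht₀, hv₀⟩ := hex
      obtain ⟨t, ht, e⟩ := all_placed_of_closed hR hv hne ht₀ hv₀ hT hv''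
      refine ⟨t, ?_, e⟩
      rw [List.mem_toFinset, mem_trisAt]
      exact ⟨ht, tmem_iff.2 (by rw [e]; exact hv'')⟩
  calc ((s.trisAt v).map fun t => M.ang (tset t) v).sum
      = ∑ t ∈ (s.trisAt v).toFinset, M.ang (tset t) v := (List.sum_toFinset _ hnd).symm
    _ = ∑ t'' ∈ ((s.trisAt v).toFinset).image tset, M.ang t'' v := by
        rw [Finset.sum_image]
        intro t ht t' ht' e
        exact hinj t (List.mem_toFinset.1 ht) t' (List.mem_toFinset.1 ht') e
    _ = ∑ t'' ∈ M.T.filter (fun t' => v ∈ t'), M.ang t'' v := by rw [himg]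
    _ = ∑ t'' ∈ M.T, M.ang t'' v := by
        rw [Finset.sum_filter]
        refine Finset.sum_congr rfl fun t'' ht'' => ?_
        split_ifs with h
        · rfl
        · exact (M.ang_zero t'' ht'' v h).symm
    _ = 2 * π := M.node v hv

/-- At an open label, the placed angle sum plus one more angle of `M` is at most `2π`.
[cite: Hales2012, proof of Lemma 9] -/
theorem sum_ang_trisAt_add_le {M : KConf κ} {s : St} (hR : Realizes M s) {v : ℕ} (hv : v < 12) {t'' : Finset ℕ}
    (hT : t'' ∈ M.T) (hv'' : v ∈ t'') (hun : ∀ t ∈ s.tris.toList, tset t ≠ t'') :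
    ((s.trisAt v).map fun t => M.ang (tset t) v).sum + M.ang t'' v ≤ 2 * π := by
  classical
  have hnd : (s.trisAt v).Nodup := by rw [trisAt_eq_filter]; exact hR.nodup.filter _
  have hinj : ∀ t ∈ (s.trisAt v).toFinset, ∀ t' ∈ (s.trisAt v).toFinset, tset t = tset t' → t = t' :=
    fun t ht t' ht' e => eq_of_tset_eq (hR.valid t (mem_trisAt.1 (List.mem_toFinset.1 ht)).1)
      (hR.valid t' (mem_trisAt.1 (List.mem_toFinset.1 ht')).1) e
  set I := ((s.trisAt v).toFinset).image tset with hI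
  have hIsub : insert t'' I ⊆ M.T := by
    intro x hx
    rw [Finset.mem_insert] at hx
    rcases hx with rfl | hx
    · exact hT
    · rw [hI, Finset.mem_image] at hx
      obtain ⟨t, ht, rfl⟩ := hx
      exact hR.mem t (mem_trisAt.1 (List.mem_toFinset.1 ht)).1
  have hnot : t'' ∉ I := by
    rw [hI, Finset.mem_image]
    rintro ⟨t, ht, e⟩
    exact hun t (mem_trisAt.1 (List.mem_toFinset.1 ht)).1 e
  calc ((s.trisAt v).map fun t => M.ang (tset t) v).sum + M.ang t'' v
      = (∑ x ∈ I, M.ang x v) + M.ang t'' v := by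
        rw [← List.sum_toFinset _ hnd, hI, Finset.sum_image hinj]
    _ = ∑ x ∈ insert t'' I, M.ang x v := by rw [Finset.sum_insert hnot, add_comm]
    _ ≤ ∑ x ∈ M.T, M.ang x v := Finset.sum_le_sum_of_subset_of_nonneg hIsub (fun x _ _ => M.ang_nonneg _ _)
    _ = 2 * π := M.node v hv

end Node

end GSearch

end Summit.Ventures.Crystal3D.Kissing125
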